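import Summits.NavierStokesRegularity.NavierStokesRegularity.Theorems.OddMorawetzLocal.Negative.OddMorawetzLocalRefutationDefsFast
import Literature.Analysis.FluidPDE.TaoAveragedEuler

/-!
# Crux `OddMorawetzLocal` (stmt-NavierStokesRegularity-1376) — refutation vocabulary IV: certificate objects and the
Morawetz pairing

Definitions only (sequel to vocabularies I–III), consumed by the certificate and assembly files of the refutation
(line `registered`, lead c1):
* `shapeOf` (multiset of jet orders of a monomial) and the kernel check `colShapePure` (the derivation columns of the
  listed representatives stay inside their shape block — the block structure of the rank certificate);
* `vecOf k q` (an integer jet polynomial read as a vector on the monomial basis `idx k`), `aMatrix k reps` (the integer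
  matrix of the derivation `der lieZ` on the normalised orbit sums of `reps`, rows = basis monomials);
* the certificate objects assembled from literal block data `(rows, cols, inverse-rows)`: `certRows`, `certCols`,
  `finOfList`, `certInvEntry`, `certB` (block-diagonal inverse mod `p`), `sVec` (isotropic basis in orbit
  coordinates), `certC`;
* `symmJets` (the submodule of 3-jets symmetric in their second and third slots — the jets of smooth fields) and
  `morawetzPairing k v τ = -∫ lin (polyOfV k τ) (jetVal v x) (jetVal (B(v,v)) x) dx`, the Euler derivative of the
  density with coefficient vector `τ` at the field `v`, as a function of `τ`.
-/

set_option linter.dupNamespace false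
set_option autoImplicit false

namespace Summit.NavierStokesRegularity.NavierStokesRegularity.Theorems.OddMorawetz

/-! ### Shapes -/

/-- Sorted insertion of a natural number. -/
def insertNat (a : ℕ) : List ℕ → List ℕ
  | [] => [a]
  | b :: bs => if b < a then b :: insertNat a bs else a :: b :: bs

/-- The shape of a monomial: the sorted list of the jet orders of its variables. -/
def shapeOf (m : List JVar) : List ℕ := (m.map fun v => v.2.length).foldr insertNat []

/-- Kernel check: for the listed representative indices, every monomial of the derivation column
`derP lieZ (orbitSumN rep)` has the shape of `rep`. -/
def colShapePure (reps : List (List JVar)) (cs : List ℕ) : Bool :=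
  cs.all fun c =>
    let rep := reps.getD c []
    (JPoly.derP lieZ (orbitSumN rep)).all fun t => shapeOf t.2 = shapeOf rep

/-! ### Vectors and the derivation matrix on orbit sums -/

/-- An integer jet polynomial read as an integer vector on the monomial basis `idx k`. -/
def vecOf (k : ℕ) (q : JPoly ℤ) : Fin (idx k).length → ℤ := fun i => JPoly.coeffOf q ((idx k).get i)

/-- The integer matrix of the derivation `der lieZ` on the normalised orbit sums of the listed representatives:
entry `(i, r)` = coefficient of the basis monomial `i` in `derP lieZ (orbitSumN reps[r])`. -/
def aMatrix (k : ℕ) (reps : List (List JVar)) : Matrix (Fin (idx k).length) (Fin reps.length) ℤ :=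
  Matrix.of fun i r => JPoly.coeffOf (JPoly.derP lieZ (orbitSumN (reps.get r))) ((idx k).get i)

/-! ### Certificate objects from block data -/

/-- Concatenated rows of the block certificates. -/
def certRows (blocks : List (List ℕ × List ℕ × List (List ℕ))) : List ℕ := blocks.flatMap fun b => b.1

/-- Concatenated columns of the block certificates. -/
def certCols (blocks : List (List ℕ × List ℕ × List (List ℕ))) : List ℕ := blocks.flatMap fun b => b.2.1

/-- A list of naturals as a map into `Fin n` (entries reduced mod `n`; the certificates only use in-range entries). -/
def finOfList (l : List ℕ) (n : ℕ) (hn : 0 < n) (t : Fin l.length) : Fin n := ⟨l.get t % n, Nat.mod_lt _ hn⟩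

/-- Entry `(s, t)` of the block-diagonal matrix assembled from the inverse blocks (global indices `s, t` in the
concatenation order; `0` off the diagonal blocks). -/
def certInvEntry : List (List ℕ × List ℕ × List (List ℕ)) → ℕ → ℕ → ℕ
  | [], _, _ => 0
  | b :: bs, s, t =>
    let n := b.1.length
    if s < n then (if t < n then ((b.2.2.getD s []).getD t 0) else 0)
    else (if t < n then 0 else certInvEntry bs (s - n) (t - n))

/-- The block-diagonal inverse of the certificate minor, mod `p`. -/
def certB (blocks : List (List ℕ × List ℕ × List (List ℕ))) (p : ℕ) :
    Matrix (Fin (certRows blocks).length) (Fin (certRows blocks).length) (ZMod p) :=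
  Matrix.of fun s t => (certInvEntry blocks s.val t.val : ZMod p)

/-- The isotropic basis element `l` in orbit coordinates (its coefficient at each representative). -/
def sVec (reps : List (List JVar)) (iso : List IsoDesc) (l : Fin iso.length) : Fin reps.length → ℤ :=
  fun r => JPoly.coeffOf (isoPolyF (iso.get l)) (reps.get r)

/-- A square inverse block given by rows, as a matrix mod `p`. -/
def certC (cinv : List (List ℕ)) (p : ℕ) : Matrix (Fin cinv.length) (Fin cinv.length) (ZMod p) :=
  Matrix.of fun a b => ((cinv.get a).getD b.val 0 : ZMod p)

/-- Kernel check of the modular independence certificate of the isotropic basis: the `kcols`-submatrix of the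
orbit-coordinate matrix times `cinv` is the identity mod `p`. -/
def isoCertCheck (reps : List (List JVar)) (iso : List IsoDesc) (kcols : List ℕ) (cinv : List (List ℕ)) (p : ℕ) :
    Bool :=
  let rows : List (List ℕ) := iso.map fun d =>
    let q := isoPolyF d
    kcols.map fun c => Int.toNat ((JPoly.coeffOf q (reps.getD c [])) % (p : ℤ))
  isIdentityList (matMulMod rows (colsToRows cinv cinv.length) p)

/-! ### Symmetric jets and the Morawetz pairing -/

/-- The submodule of 3-jets whose second and third slots are symmetric multilinear maps (the 3-jets of smooth
fields). -/
noncomputable def symmJets : Submodule ℝ Jet3 where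
  carrier := {z | (∀ (w : Fin 2 → EuclideanSpace ℝ (Fin 3)) (σ : Equiv.Perm (Fin 2)), z.2.2.1 (w ∘ σ) = z.2.2.1 w) ∧
    (∀ (w : Fin 3 → EuclideanSpace ℝ (Fin 3)) (σ : Equiv.Perm (Fin 3)), z.2.2.2 (w ∘ σ) = z.2.2.2 w)}
  add_mem' := by
    intro a b ha hb
    refine ⟨fun w σ => ?_, fun w σ => ?_⟩
    · simp only [Prod.snd_add, Prod.fst_add, add_apply, ha.1 w σ, hb.1 w σ]
    · simp only [Prod.snd_add, add_apply, ha.2 w σ, hb.2 w σ]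
  zero_mem' := by
    refine ⟨fun w σ => ?_, fun w σ => ?_⟩ <;> simp
  smul_mem' := by
    intro c z hz
    refine ⟨fun w σ => ?_, fun w σ => ?_⟩
    · simp only [Prod.smul_snd, Prod.smul_fst, smul_apply, hz.1 w σ]
    · simp only [Prod.smul_snd, smul_apply, hz.2 w σ]

/-- The Morawetz pairing: the Euler derivative `-∫ Dm(Jv)[J B(v,v)]` of the density with coefficient vector `τ`
(on the weight-`k` basis), written with the linearisation `lin` on the concrete jets — a linear function of `τ`. -/
noncomputable def morawetzPairing (k : ℕ) (v : EuclideanSpace ℝ (Fin 3) → EuclideanSpace ℝ (Fin 3)) (τ : V k) : ℝ :=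
  -∫ x, JPoly.lin (polyOfV k τ) (jetVal v x) (jetVal (Literature.Analysis.FluidPDE.eulerBilinear v v) x)

end Summit.NavierStokesRegularity.NavierStokesRegularity.Theorems.OddMorawetz
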